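import Mathlib.Analysis.SpecialFunctions.Complex.Circle
import Mathlib.Topology.Homotopy.Lifting
import Mathlib.Analysis.Convex.Contractible
import Mathlib.AlgebraicTopology.FundamentalGroupoid.SimplyConnected
import Literature.Analysis.SpecialFunctions.PeriodicArgComp
import HarnessLib

/-!
# Smooth real lifts (angle functions) of smooth unit-complex-valued functions on the line

Topic `Literature/Analysis/SpecialFunctions`.  The covering-space remark behind every "choose a
continuous branch of the angle" (Hatcher, *Algebraic Topology* (2002), Prop. 1.30 / §1.1; for the
smooth version Bröcker–Jänich, *Introduction to Differential Topology* (1982), §(10.x) exercises, or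
any ODE text: `ψ' = Im(v' v̄)`): **a `C^n` map `v : ℝ → ℂ` with `|v| = 1` is `e^{iψ}` for a `C^n`
real function `ψ`**, unique up to `2πℤ`.  PROVED here from Mathlib's covering map
`Circle.exp : ℝ → Circle` (`Circle.isCoveringMap_exp`) and unique lifting over the simply
connected, locally path-connected base `ℝ` (`IsCoveringMap.existsUnique_continuousMap_lifts`),
plus local smoothness of the lift: near `t₀` it is `ψ t₀ + arg (v t / v t₀)` and `arg` is
real-analytic on the slit plane (`contDiffAt_arg_of_mem_slitPlane`, this topic).

* `exists_continuous_lift_of_norm_eq_one` — continuous `v`, `|v| = 1` ⇒ `v = exp (ψ · I)`,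
  `ψ` continuous;
* `contDiffAt_lift_of_norm_eq_one` — any continuous lift of a `C^n` map is `C^n`;
* `exists_contDiff_lift_of_norm_eq_one` — the `C^n` statement (every `n : WithTop ℕ∞`).

[folklore]

## References

* A. Hatcher, *Algebraic Topology*, CUP (2002), Prop. 1.30 and Prop. 1.33. [HatcherAT2002]
* Mathlib `Circle.isCoveringMap_exp`, `IsCoveringMap.existsUnique_continuousMap_lifts`.
-/

noncomputable section

open Complex Set Filter
open scoped Topology Real

namespace Literature.Analysis.SpecialFunctions

/-- A unit complex number as a point of Mathlib's `Circle`. [folklore] -/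
theorem mem_unitSphere_of_norm_eq_one {z : ℂ} (hz : ‖z‖ = 1) : z ∈ Submonoid.unitSphere ℂ := by
  simpa [Submonoid.unitSphere] using hz

/-- **Continuous angle functions exist**: a continuous `v : ℝ → ℂ` with `|v| = 1` is `e^{iψ}`
for a continuous real `ψ`. [cite: HatcherAT2002, Prop. 1.30] -/
theorem exists_continuous_lift_of_norm_eq_one {v : ℝ → ℂ} (hv : Continuous v)
    (h1 : ∀ t, ‖v t‖ = 1) : ∃ ψ : ℝ → ℝ, Continuous ψ ∧ ∀ t, v t = exp (ψ t * I) := by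
  set V : C(ℝ, Circle) :=
    ⟨fun t ↦ ⟨v t, mem_unitSphere_of_norm_eq_one (h1 t)⟩, hv.subtype_mk _⟩ with hV
  have he : Circle.exp (arg (v 0)) = V 0 := by
    apply Subtype.ext
    rw [Circle.coe_exp]
    have h := norm_mul_exp_arg_mul_I (v 0)
    rw [h1 0, Complex.ofReal_one, one_mul] at h
    exact h
  obtain ⟨F, ⟨-, hF⟩, -⟩ :=
    Circle.isCoveringMap_exp.existsUnique_continuousMap_lifts V 0 (arg (v 0)) he
  refine ⟨F, F.continuous, fun t ↦ ?_⟩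
  have h := congrArg (fun f ↦ ((f t : Circle) : ℂ)) hF
  simp only [Function.comp_apply, Circle.coe_exp] at h
  rw [h, hV]
  rfl

/-- **A continuous angle function of a `C^n` map is `C^n`**: near `t₀` it equals
`ψ t₀ + arg (v t · (v t₀)⁻¹)`, and `arg` is `C^n` on the slit plane. [folklore] -/
theorem contDiffAt_lift_of_norm_eq_one {n : WithTop ℕ∞} {v : ℝ → ℂ} (hv : ContDiff ℝ n v)
    (h1 : ∀ t, ‖v t‖ = 1) {ψ : ℝ → ℝ} (hψ : Continuous ψ) (hlift : ∀ t, v t = exp (ψ t * I))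
    (t₀ : ℝ) : ContDiffAt ℝ n ψ t₀ := by
  have hv0 : ∀ t, v t ≠ 0 := fun t h ↦ by simpa [h] using h1 t
  -- the quotient `q t = v t / v t₀`, `q t₀ = 1`
  set q : ℝ → ℂ := fun t ↦ v t * (v t₀)⁻¹ with hq
  have hqd : ContDiff ℝ n q := hv.mul contDiff_const
  have hq0 : q t₀ = 1 := by simp [hq, hv0 t₀]
  have hq1 : ∀ t, ‖q t‖ = 1 := fun t ↦ by simp [hq, h1]
  have hqexp : ∀ t, q t = exp (((ψ t - ψ t₀ : ℝ) : ℂ) * I) := fun t ↦ by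
    show v t * (v t₀)⁻¹ = _
    rw [hlift t, hlift t₀, Complex.ofReal_sub, sub_mul, Complex.exp_sub, div_eq_mul_inv]
  have hargexp : ∀ t, exp ((arg (q t) : ℂ) * I) = q t := fun t ↦ by
    have h := norm_mul_exp_arg_mul_I (q t)
    rwa [hq1 t, Complex.ofReal_one, one_mul] at h
  -- the defect `ψ t - ψ t₀ - arg (q t)` is an integer multiple of `2π`, continuous at `t₀`, zero there
  set g : ℝ → ℝ := fun t ↦ ψ t - ψ t₀ - arg (q t) with hg
  have hgint : ∀ t, ∃ m : ℤ, g t = m * (2 * π) := fun t ↦ by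
    have h : exp ((g t : ℂ) * I) = 1 := by
      rw [hg]
      push_cast
      rw [sub_mul, Complex.exp_sub]
      have h2 := hqexp t
      push_cast at h2
      rw [← h2, hargexp t, div_self (by rw [hqexp t]; exact Complex.exp_ne_zero _)]
    obtain ⟨m, hm⟩ := Complex.exp_eq_one_iff.1 h
    refine ⟨m, ?_⟩
    have h3 := congrArg Complex.im hm
    simp at h3
    linarith
  have hg0 : g t₀ = 0 := by simp [hg, hq0]
  have hslit : ∀ᶠ t in 𝓝 t₀, q t ∈ slitPlane := by
    refine hqd.continuous.continuousAt.preimage_mem_nhds (isOpen_slitPlane.mem_nhds ?_)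
    rw [hq0]; exact one_mem_slitPlane
  have hgc : ContinuousAt g t₀ := by
    refine (hψ.continuousAt.sub continuousAt_const).sub ?_
    exact (continuousAt_arg (by rw [hq0]; exact one_mem_slitPlane)).comp hqd.continuous.continuousAt
  have hsmall : ∀ᶠ t in 𝓝 t₀, |g t| < 2 * π := by
    have h := hgc.eventually (Metric.ball_mem_nhds (g t₀) Real.two_pi_pos)
    filter_upwards [h] with t ht
    rwa [hg0, dist_zero_right, Real.norm_eq_abs] at ht
  have hzero : ∀ᶠ t in 𝓝 t₀, g t = 0 := by
    filter_upwards [hsmall] with t ht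
    obtain ⟨m, hm⟩ := hgint t
    rw [hm, abs_mul, abs_of_pos Real.two_pi_pos] at ht
    have h2 : |(m : ℝ)| < 1 := by
      by_contra hh
      push Not at hh
      nlinarith [Real.two_pi_pos]
    have h3 : m = 0 := by
      have : |m| < 1 := by exact_mod_cast h2
      exact Int.abs_lt_one_iff.1 this
    rw [hm, h3]; simp
  -- hence `ψ = ψ t₀ + arg ∘ q` near `t₀`, which is `C^n`
  have heq : ψ =ᶠ[𝓝 t₀] fun t ↦ ψ t₀ + arg (q t) := by
    filter_upwards [hzero] with t ht
    simp only [hg] at ht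
    linarith
  refine ContDiffAt.congr_of_eventuallyEq ?_ heq
  exact contDiffAt_const.add
    ((contDiffAt_arg_of_mem_slitPlane (by rw [hq0]; exact one_mem_slitPlane)).comp t₀ hqd.contDiffAt)

/-- **Smooth angle functions exist**: a `C^n` map `v : ℝ → ℂ` with `|v| = 1` is `e^{iψ}` for a
`C^n` real function `ψ` (every `n : WithTop ℕ∞`). [cite: HatcherAT2002, Prop. 1.30] -/
theorem exists_contDiff_lift_of_norm_eq_one {n : WithTop ℕ∞} {v : ℝ → ℂ} (hv : ContDiff ℝ n v)
    (h1 : ∀ t, ‖v t‖ = 1) : ∃ ψ : ℝ → ℝ, ContDiff ℝ n ψ ∧ ∀ t, v t = exp (ψ t * I) := by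
  obtain ⟨ψ, hψ, hlift⟩ := exists_continuous_lift_of_norm_eq_one hv.continuous h1
  exact ⟨ψ, contDiff_iff_contDiffAt.2 fun t₀ ↦ contDiffAt_lift_of_norm_eq_one hv h1 hψ hlift t₀,
    hlift⟩

/-- Two continuous angle functions of the same map differ by a constant multiple of `2π`.
[folklore] -/
theorem lift_sub_lift_eq_const {v : ℝ → ℂ} {ψ₁ ψ₂ : ℝ → ℝ} (hψ₁ : Continuous ψ₁)
    (hψ₂ : Continuous ψ₂) (h₁ : ∀ t, v t = exp (ψ₁ t * I)) (h₂ : ∀ t, v t = exp (ψ₂ t * I)) :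
    ∃ m : ℤ, ∀ t, ψ₁ t - ψ₂ t = m * (2 * π) := by
  have hint : ∀ t, ∃ m : ℤ, ψ₁ t - ψ₂ t = m * (2 * π) := fun t ↦ by
    have h : exp (((ψ₁ t - ψ₂ t : ℝ) : ℂ) * I) = 1 := by
      push_cast
      rw [sub_mul, Complex.exp_sub, ← h₁ t, ← h₂ t, div_self]
      rw [h₁ t]; exact Complex.exp_ne_zero _
    obtain ⟨m, hm⟩ := Complex.exp_eq_one_iff.1 h
    refine ⟨m, ?_⟩
    have h3 := congrArg Complex.im hm
    simp at h3
    linarith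
  -- the continuous function `(ψ₁ - ψ₂)/(2π)` takes integer values on the connected line
  choose m hm using hint
  have hcont : Continuous fun t ↦ ((m t : ℝ)) := by
    have : (fun t ↦ ((m t : ℝ))) = fun t ↦ (ψ₁ t - ψ₂ t) / (2 * π) := by
      funext t; rw [hm t]; field_simp
    rw [this]
    exact (hψ₁.sub hψ₂).div_const _
  have hmc : Continuous m := Int.isClosedEmbedding_coe_real.isEmbedding.continuous_iff.2 hcont
  have hconst : ∀ t, m t = m 0 := fun t ↦ PreconnectedSpace.constant inferInstance hmc
  exact ⟨m 0, fun t ↦ by rw [← hconst t]; exact hm t⟩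

end Literature.Analysis.SpecialFunctions

end
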